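import Summits.Langlands.Langlands.Theses.CofinitePrimeSplit
import Literature.NumberTheory.Automorphic.EssConjSelfDual
/-!
BC3 BIRTH SKELETON — crux IPT `IrreduciblePrimeTransport` (DECLARED RESIDUAL) of the child route `CofinitePrimeSplit` (lens-5 g16; refines NRM
stmt-Langlands-31315).  POST-BIRTH form (imports the born route file; concludes the item BY NAME).
Three registered stubs = the transport cut by RANK REGIME, each with its own toolbox: `stub_ipt_le3` (n ≤ 3: print islands — rank one trivial;
GL₂ Ribet/Taylor-type; GL₃ Blasius–Rogawski / Böckle–Hui 2025), `stub_ipt_prime` (prime n ≥ 5: a generic irreducible member is tensor-indecomposable,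
λ-independence of the formal character then pins every member — the argument of `OrdinaryPrimeTransport.PrimeRankTransport` 17213 with a COFINITE
instead of a one-prime input; IDEA-NEEDED), `stub_ipt_composite` (composite n ≥ 4: needs Larsen–Pink-strength λ-independence; GL₄/TR island Shavali
2026; dark), and the kernel-checked composition `IrreduciblePrimeTransport_of` (trichotomy on n).  sorries ONLY inside `stub_*`.
-/
set_option linter.dupNamespace false
open scoped BigOperators Topology Manifold Classical MeasureTheory ProbabilityTheory Matrix InnerProductSpace ComplexConjugate ContinuousMap
open Filter Set Function TopologicalSpace MeasureTheory
-- SKELETON SHAPE (writer-1 g6 fix for `skeleton.extra-hypothesis`): the composition `IrreduciblePrimeTransport_of` (hypotheses = stub statements) is folded into ONE closed theorem `IrreduciblePrimeTransport_proof : <route decl>` whose `have` lines invoke the sorried stubs; proof body unchanged.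
namespace Summit.Langlands.Langlands.Cruxes.IrreduciblePrimeTransport.Birth

/-- LOW RANK n ≤ 3 (print islands): n = 1 — every rank-one ρ is irreducible (tree `IrreducibleOffSector.isIrreducible_of_rank_one`); n = 2, 3 — a
semisimple Satake-compatible family of a CUSPIDAL π that is irreducible at almost all primes cannot acquire an abelian / (2+1) constituent at one prime
without contradicting λ-independence of the connected monodromy's rank-≤ 3 type (type A₁ / A₂ maximality, Hui 2023 §1; Böckle–Hui 2025 over totally
real K [corpus:paper:arxiv-2404.08954 p2]); over general K this is referee-grade.  Size M–L. -/
theorem stub_ipt_le3 : ∀ (K : Type) [Field K] [NumberField K] (n : ℕ) (hcpt : Literature.NumberTheory.Automorphic.isCompact_glFiniteIntegralLevel n K), 0 < n → n ≤ 3 → ∀ (π : Literature.NumberTheory.Automorphic.CuspidalAutomorphicRepData n K hcpt), π.1.IsLAlgebraic → ¬ (∃ (v : IsDedekindDomain.HeightOneSpectrum (NumberField.RingOfIntegers K)) (πv : Literature.NumberTheory.Automorphic.SmoothIrrep (Matrix.GeneralLinearGroup (Fin n) (v.adicCompletion K))), π.1.HasLocalComponentAt v πv.ρ ∧ (∀ [MeasurableSpace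 (Matrix.GeneralLinearGroup (Fin n) (v.adicCompletion K) ⧸ Subgroup.center (Matrix.GeneralLinearGroup (Fin n) (v.adicCompletion K)))] [BorelSpace (Matrix.GeneralLinearGroup (Fin n) (v.adicCompletion K) ⧸ Subgroup.center (Matrix.GeneralLinearGroup (Fin n) (v.adicCompletion K)))] (μ : MeasureTheory.Measure (Matrix.GeneralLinearGroup (Fin n) (v.adicCompletion K) ⧸ Subgroup.center (Matrix.GeneralLinearGroup (Fin n) (v.adicCompletion K)))) [μ.IsHaarMeasure], πv.ρ.IsEssentiallyDiscreteSeries μ) ∧ ∃ χ : Matrix.GeneralLinearGroup (Fin n) (v.adicCompletion K) →* ℂˣ, IsOpen (χ.ker : Set (Matrix.GeneralLinearGroup (Fin n) (v.adicCompletion K))) ∧ ∃ w : πv.V, w ≠ 0 ∧ ∀ g ∈ Literature.NumberTheory.Automorphic.iwahoriGL n (v.adicCompletion K), (πv.ρ.twist χ) g w = w) → (∀ m : ℕ, m < n → ∀ (K : Type) [Field K] [NumberField K] (hcpt : Literature.NumberTheory.Automorphic.isCompact_glFiniteIntegralLevel m K), 0 < m → ∀ (π : Literature.NumberTheory.Automorphic.CuspidalAutomorphicRepData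 m K hcpt), π.1.IsLAlgebraic → ∀ (ℓ : ℕ) [Fact ℓ.Prime] (ι : PadicAlgCl ℓ ≃+* ℂ) (ρ : Literature.NumberTheory.GaloisRepresentations.FramedGaloisRep K (PadicAlgCl ℓ) m), ρ.toGaloisRep.IsSemisimple → (∀ᶠ v : IsDedekindDomain.HeightOneSpectrum (NumberField.RingOfIntegers K) in cofinite, SatakeFrobCompatibleAt ι π.1 ρ v) → ρ.toGaloisRep.IsIrreducible) → (∀ (ℓ : ℕ) [Fact ℓ.Prime] (ι : PadicAlgCl ℓ ≃+* ℂ), ∃ ρ : Literature.NumberTheory.GaloisRepresentations.FramedGaloisRep K (PadicAlgCl ℓ) n, ρ.toGaloisRep.IsSemisimple ∧ ∀ᶠ v : IsDedekindDomain.HeightOneSpectrum (NumberField.RingOfIntegers K) in cofinite, SatakeFrobCompatibleAt ι π.1 ρ v) → (∃ S : Finset ℕ, ∀ (ℓ : ℕ) [Fact ℓ.Prime], ℓ ∉ S → ∀ (ι : PadicAlgCl ℓ ≃+* ℂ) (ρ : Literature.NumberTheory.GaloisRepresentations.FramedGaloisRep K (PadicAlgCl ℓ) n), ρ.toGaloisRep.IsSemisimple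 → (∀ᶠ v : IsDedekindDomain.HeightOneSpectrum (NumberField.RingOfIntegers K) in cofinite, SatakeFrobCompatibleAt ι π.1 ρ v) → ρ.toGaloisRep.IsIrreducible) → ∀ (ℓ : ℕ) [Fact ℓ.Prime] (ι : PadicAlgCl ℓ ≃+* ℂ) (ρ : Literature.NumberTheory.GaloisRepresentations.FramedGaloisRep K (PadicAlgCl ℓ) n), ρ.toGaloisRep.IsSemisimple → (∀ᶠ v : IsDedekindDomain.HeightOneSpectrum (NumberField.RingOfIntegers K) in cofinite, SatakeFrobCompatibleAt ι π.1 ρ v) → ρ.toGaloisRep.IsIrreducible := by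
  sorry

/-- PRIME RANK n ≥ 5 (IDEA-NEEDED; the cofinite sharpening of `OrdinaryPrimeTransport.PrimeRankTransport` stmt-Langlands-17213): in prime dimension an
irreducible member with infinite image is Lie-irreducible or induced/Artin up to twist; λ-independence of the formal bi-character (Hui 2013 MRL Thm 3.19)
and of the component group transports tensor-indecomposability to every prime.  Why it might fail: an Artin-type (finite-image) constituent pattern at
the exceptional prime is invisible to the formal character.  Size L. -/
theorem stub_ipt_prime : ∀ (K : Type) [Field K] [NumberField K] (n : ℕ) (hcpt : Literature.NumberTheory.Automorphic.isCompact_glFiniteIntegralLevel n K), 0 < n → 3 < n → n.Prime → ∀ (π : Literature.NumberTheory.Automorphic.CuspidalAutomorphicRepData n K hcpt), π.1.IsLAlgebraic → ¬ (∃ (v : IsDedekindDomain.HeightOneSpectrum (NumberField.RingOfIntegers K)) (πv : Literature.NumberTheory.Automorphic.SmoothIrrep (Matrix.GeneralLinearGroup (Fin n) (v.adicCompletion K))), π.1.HasLocalComponentAt v πv.ρ ∧ (∀ [MeasurableSpace (Matrix.GeneralLinearGroup (Fin n) (v.adicCompletion K) ⧸ Subgroup.center (Matrix.GeneralLinearGroup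 (Fin n) (v.adicCompletion K)))] [BorelSpace (Matrix.GeneralLinearGroup (Fin n) (v.adicCompletion K) ⧸ Subgroup.center (Matrix.GeneralLinearGroup (Fin n) (v.adicCompletion K)))] (μ : MeasureTheory.Measure (Matrix.GeneralLinearGroup (Fin n) (v.adicCompletion K) ⧸ Subgroup.center (Matrix.GeneralLinearGroup (Fin n) (v.adicCompletion K)))) [μ.IsHaarMeasure], πv.ρ.IsEssentiallyDiscreteSeries μ) ∧ ∃ χ : Matrix.GeneralLinearGroup (Fin n) (v.adicCompletion K) →* ℂˣ, IsOpen (χ.ker : Set (Matrix.GeneralLinearGroup (Fin n) (v.adicCompletion K))) ∧ ∃ w : πv.V, w ≠ 0 ∧ ∀ g ∈ Literature.NumberTheory.Automorphic.iwahoriGL n (v.adicCompletion K), (πv.ρ.twist χ) g w = w) → (∀ m : ℕ, m < n → ∀ (K : Type) [Field K] [NumberField K] (hcpt : Literature.NumberTheory.Automorphic.isCompact_glFiniteIntegralLevel m K), 0 < m → ∀ (π : Literature.NumberTheory.Automorphic.CuspidalAutomorphicRepData m K hcpt), π.1.IsLAlgebraic → ∀ (ℓ : ℕ) [Fact ℓ.Prime]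 (ι : PadicAlgCl ℓ ≃+* ℂ) (ρ : Literature.NumberTheory.GaloisRepresentations.FramedGaloisRep K (PadicAlgCl ℓ) m), ρ.toGaloisRep.IsSemisimple → (∀ᶠ v : IsDedekindDomain.HeightOneSpectrum (NumberField.RingOfIntegers K) in cofinite, SatakeFrobCompatibleAt ι π.1 ρ v) → ρ.toGaloisRep.IsIrreducible) → (∀ (ℓ : ℕ) [Fact ℓ.Prime] (ι : PadicAlgCl ℓ ≃+* ℂ), ∃ ρ : Literature.NumberTheory.GaloisRepresentations.FramedGaloisRep K (PadicAlgCl ℓ) n, ρ.toGaloisRep.IsSemisimple ∧ ∀ᶠ v : IsDedekindDomain.HeightOneSpectrum (NumberField.RingOfIntegers K) in cofinite, SatakeFrobCompatibleAt ι π.1 ρ v) → (∃ S : Finset ℕ, ∀ (ℓ : ℕ) [Fact ℓ.Prime], ℓ ∉ S → ∀ (ι : PadicAlgCl ℓ ≃+* ℂ) (ρ : Literature.NumberTheory.GaloisRepresentations.FramedGaloisRep K (PadicAlgCl ℓ) n), ρ.toGaloisRep.IsSemisimple → (∀ᶠ v : IsDedekindDomain.HeightOneSpectrum (NumberField.RingOfIntegers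 K) in cofinite, SatakeFrobCompatibleAt ι π.1 ρ v) → ρ.toGaloisRep.IsIrreducible) → ∀ (ℓ : ℕ) [Fact ℓ.Prime] (ι : PadicAlgCl ℓ ≃+* ℂ) (ρ : Literature.NumberTheory.GaloisRepresentations.FramedGaloisRep K (PadicAlgCl ℓ) n), ρ.toGaloisRep.IsSemisimple → (∀ᶠ v : IsDedekindDomain.HeightOneSpectrum (NumberField.RingOfIntegers K) in cofinite, SatakeFrobCompatibleAt ι π.1 ρ v) → ρ.toGaloisRep.IsIrreducible := by
  sorry

/-- COMPOSITE RANK n ≥ 4, n not prime (dark): the exceptional-prime member could be tensor-decomposable or a sum of equal-rank blocks with the same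
formal character as an irreducible one — excluding this is Larsen–Pink-conjecture strength (known: GL₄ over totally real fields, Shavali 2026
[corpus:paper:arxiv-2603.19768 p2]; six-dimensional self-dual systems «one irreducible ⇒ almost all», Dai 2025 [corpus:paper:arxiv-2503.04541 p2] —
the converse direction of what is needed here).  Size XL / open. -/
theorem stub_ipt_composite : ∀ (K : Type) [Field K] [NumberField K] (n : ℕ) (hcpt : Literature.NumberTheory.Automorphic.isCompact_glFiniteIntegralLevel n K), 0 < n → 3 < n → ¬ n.Prime → ∀ (π : Literature.NumberTheory.Automorphic.CuspidalAutomorphicRepData n K hcpt), π.1.IsLAlgebraic → ¬ (∃ (v : IsDedekindDomain.HeightOneSpectrum (NumberField.RingOfIntegers K)) (πv : Literature.NumberTheory.Automorphic.SmoothIrrep (Matrix.GeneralLinearGroup (Fin n) (v.adicCompletion K))), π.1.HasLocalComponentAt v πv.ρ ∧ (∀ [MeasurableSpace (Matrix.GeneralLinearGroup (Fin n) (v.adicCompletion K) ⧸ Subgroup.center (Matrix.GeneralLinearGroup (Fin n) (v.adicCompletion K)))] [BorelSpace (Matrix.GeneralLinearGroup (Fin n) (v.adicCompletion K) ⧸ Subgroup.center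 (Matrix.GeneralLinearGroup (Fin n) (v.adicCompletion K)))] (μ : MeasureTheory.Measure (Matrix.GeneralLinearGroup (Fin n) (v.adicCompletion K) ⧸ Subgroup.center (Matrix.GeneralLinearGroup (Fin n) (v.adicCompletion K)))) [μ.IsHaarMeasure], πv.ρ.IsEssentiallyDiscreteSeries μ) ∧ ∃ χ : Matrix.GeneralLinearGroup (Fin n) (v.adicCompletion K) →* ℂˣ, IsOpen (χ.ker : Set (Matrix.GeneralLinearGroup (Fin n) (v.adicCompletion K))) ∧ ∃ w : πv.V, w ≠ 0 ∧ ∀ g ∈ Literature.NumberTheory.Automorphic.iwahoriGL n (v.adicCompletion K), (πv.ρ.twist χ) g w = w) → (∀ m : ℕ, m < n → ∀ (K : Type) [Field K] [NumberField K] (hcpt : Literature.NumberTheory.Automorphic.isCompact_glFiniteIntegralLevel m K), 0 < m → ∀ (π : Literature.NumberTheory.Automorphic.CuspidalAutomorphicRepData m K hcpt), π.1.IsLAlgebraic → ∀ (ℓ : ℕ) [Fact ℓ.Prime] (ι : PadicAlgCl ℓ ≃+* ℂ) (ρ : Literature.NumberTheory.GaloisRepresentations.FramedGaloisRep K (PadicAlgCl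 ℓ) m), ρ.toGaloisRep.IsSemisimple → (∀ᶠ v : IsDedekindDomain.HeightOneSpectrum (NumberField.RingOfIntegers K) in cofinite, SatakeFrobCompatibleAt ι π.1 ρ v) → ρ.toGaloisRep.IsIrreducible) → (∀ (ℓ : ℕ) [Fact ℓ.Prime] (ι : PadicAlgCl ℓ ≃+* ℂ), ∃ ρ : Literature.NumberTheory.GaloisRepresentations.FramedGaloisRep K (PadicAlgCl ℓ) n, ρ.toGaloisRep.IsSemisimple ∧ ∀ᶠ v : IsDedekindDomain.HeightOneSpectrum (NumberField.RingOfIntegers K) in cofinite, SatakeFrobCompatibleAt ι π.1 ρ v) → (∃ S : Finset ℕ, ∀ (ℓ : ℕ) [Fact ℓ.Prime], ℓ ∉ S → ∀ (ι : PadicAlgCl ℓ ≃+* ℂ) (ρ : Literature.NumberTheory.GaloisRepresentations.FramedGaloisRep K (PadicAlgCl ℓ) n), ρ.toGaloisRep.IsSemisimple → (∀ᶠ v : IsDedekindDomain.HeightOneSpectrum (NumberField.RingOfIntegers K) in cofinite, SatakeFrobCompatibleAt ι π.1 ρ v) → ρ.toGaloisRep.IsIrreducible) → ∀ (ℓ :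 ℕ) [Fact ℓ.Prime] (ι : PadicAlgCl ℓ ≃+* ℂ) (ρ : Literature.NumberTheory.GaloisRepresentations.FramedGaloisRep K (PadicAlgCl ℓ) n), ρ.toGaloisRep.IsSemisimple → (∀ᶠ v : IsDedekindDomain.HeightOneSpectrum (NumberField.RingOfIntegers K) in cofinite, SatakeFrobCompatibleAt ι π.1 ρ v) → ρ.toGaloisRep.IsIrreducible := by
  sorry

/-- KERNEL-CHECKED COMPOSITION (real proof, no sorry): trichotomy n ≤ 3 ∣ prime n > 3 ∣ composite n > 3 rebuilds IPT BY NAME. -/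
theorem IrreduciblePrimeTransport_proof :
    Summit.Langlands.Langlands.Theses.CofinitePrimeSplit.IrreduciblePrimeTransport := by
  have hle : ∀ (K : Type) [Field K] [NumberField K] (n : ℕ) (hcpt : Literature.NumberTheory.Automorphic.isCompact_glFiniteIntegralLevel n K), 0 < n → n ≤ 3 → ∀ (π : Literature.NumberTheory.Automorphic.CuspidalAutomorphicRepData n K hcpt), π.1.IsLAlgebraic → ¬ (∃ (v : IsDedekindDomain.HeightOneSpectrum (NumberField.RingOfIntegers K)) (πv : Literature.NumberTheory.Automorphic.SmoothIrrep (Matrix.GeneralLinearGroup (Fin n) (v.adicCompletion K))), π.1.HasLocalComponentAt v πv.ρ ∧ (∀ [MeasurableSpace (Matrix.GeneralLinearGroup (Fin n) (v.adicCompletion K) ⧸ Subgroup.center (Matrix.GeneralLinearGroup (Fin n) (v.adicCompletion K)))] [BorelSpace (Matrix.GeneralLinearGroup (Fin n) (v.adicCompletion K) ⧸ Subgroup.center (Matrix.GeneralLinearGroup (Fin n) (v.adicCompletion K)))] (μ : MeasureTheory.Measure (Matrix.GeneralLinearGroup (Fin n) (v.adicCompletion K) ⧸ Subgroup.center (Matrix.GeneralLinearGroup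 (Fin n) (v.adicCompletion K)))) [μ.IsHaarMeasure], πv.ρ.IsEssentiallyDiscreteSeries μ) ∧ ∃ χ : Matrix.GeneralLinearGroup (Fin n) (v.adicCompletion K) →* ℂˣ, IsOpen (χ.ker : Set (Matrix.GeneralLinearGroup (Fin n) (v.adicCompletion K))) ∧ ∃ w : πv.V, w ≠ 0 ∧ ∀ g ∈ Literature.NumberTheory.Automorphic.iwahoriGL n (v.adicCompletion K), (πv.ρ.twist χ) g w = w) → (∀ m : ℕ, m < n → ∀ (K : Type) [Field K] [NumberField K] (hcpt : Literature.NumberTheory.Automorphic.isCompact_glFiniteIntegralLevel m K), 0 < m → ∀ (π : Literature.NumberTheory.Automorphic.CuspidalAutomorphicRepData m K hcpt), π.1.IsLAlgebraic → ∀ (ℓ : ℕ) [Fact ℓ.Prime] (ι : PadicAlgCl ℓ ≃+* ℂ) (ρ : Literature.NumberTheory.GaloisRepresentations.FramedGaloisRep K (PadicAlgCl ℓ) m), ρ.toGaloisRep.IsSemisimple → (∀ᶠ v : IsDedekindDomain.HeightOneSpectrum (NumberField.RingOfIntegers K) in cofinite, SatakeFrobCompatibleAt ι π.1 ρ v) →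 ρ.toGaloisRep.IsIrreducible) → (∀ (ℓ : ℕ) [Fact ℓ.Prime] (ι : PadicAlgCl ℓ ≃+* ℂ), ∃ ρ : Literature.NumberTheory.GaloisRepresentations.FramedGaloisRep K (PadicAlgCl ℓ) n, ρ.toGaloisRep.IsSemisimple ∧ ∀ᶠ v : IsDedekindDomain.HeightOneSpectrum (NumberField.RingOfIntegers K) in cofinite, SatakeFrobCompatibleAt ι π.1 ρ v) → (∃ S : Finset ℕ, ∀ (ℓ : ℕ) [Fact ℓ.Prime], ℓ ∉ S → ∀ (ι : PadicAlgCl ℓ ≃+* ℂ) (ρ : Literature.NumberTheory.GaloisRepresentations.FramedGaloisRep K (PadicAlgCl ℓ) n), ρ.toGaloisRep.IsSemisimple → (∀ᶠ v : IsDedekindDomain.HeightOneSpectrum (NumberField.RingOfIntegers K) in cofinite, SatakeFrobCompatibleAt ι π.1 ρ v) → ρ.toGaloisRep.IsIrreducible) → ∀ (ℓ : ℕ) [Fact ℓ.Prime] (ι : PadicAlgCl ℓ ≃+* ℂ) (ρ : Literature.NumberTheory.GaloisRepresentations.FramedGaloisRep K (PadicAlgCl ℓ) n), ρ.toGaloisRep.IsSemisimple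 → (∀ᶠ v : IsDedekindDomain.HeightOneSpectrum (NumberField.RingOfIntegers K) in cofinite, SatakeFrobCompatibleAt ι π.1 ρ v) → ρ.toGaloisRep.IsIrreducible := stub_ipt_le3
  have hpr : ∀ (K : Type) [Field K] [NumberField K] (n : ℕ) (hcpt : Literature.NumberTheory.Automorphic.isCompact_glFiniteIntegralLevel n K), 0 < n → 3 < n → n.Prime → ∀ (π : Literature.NumberTheory.Automorphic.CuspidalAutomorphicRepData n K hcpt), π.1.IsLAlgebraic → ¬ (∃ (v : IsDedekindDomain.HeightOneSpectrum (NumberField.RingOfIntegers K)) (πv : Literature.NumberTheory.Automorphic.SmoothIrrep (Matrix.GeneralLinearGroup (Fin n) (v.adicCompletion K))), π.1.HasLocalComponentAt v πv.ρ ∧ (∀ [MeasurableSpace (Matrix.GeneralLinearGroup (Fin n) (v.adicCompletion K) ⧸ Subgroup.center (Matrix.GeneralLinearGroup (Fin n) (v.adicCompletion K)))] [BorelSpace (Matrix.GeneralLinearGroup (Fin n) (v.adicCompletion K) ⧸ Subgroup.center (Matrix.GeneralLinearGroup (Fin n) (v.adicCompletion K)))] (μ : MeasureTheory.Measure (Matrix.GeneralLinearGroup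 (Fin n) (v.adicCompletion K) ⧸ Subgroup.center (Matrix.GeneralLinearGroup (Fin n) (v.adicCompletion K)))) [μ.IsHaarMeasure], πv.ρ.IsEssentiallyDiscreteSeries μ) ∧ ∃ χ : Matrix.GeneralLinearGroup (Fin n) (v.adicCompletion K) →* ℂˣ, IsOpen (χ.ker : Set (Matrix.GeneralLinearGroup (Fin n) (v.adicCompletion K))) ∧ ∃ w : πv.V, w ≠ 0 ∧ ∀ g ∈ Literature.NumberTheory.Automorphic.iwahoriGL n (v.adicCompletion K), (πv.ρ.twist χ) g w = w) → (∀ m : ℕ, m < n → ∀ (K : Type) [Field K] [NumberField K] (hcpt : Literature.NumberTheory.Automorphic.isCompact_glFiniteIntegralLevel m K), 0 < m → ∀ (π : Literature.NumberTheory.Automorphic.CuspidalAutomorphicRepData m K hcpt), π.1.IsLAlgebraic → ∀ (ℓ : ℕ) [Fact ℓ.Prime] (ι : PadicAlgCl ℓ ≃+* ℂ) (ρ : Literature.NumberTheory.GaloisRepresentations.FramedGaloisRep K (PadicAlgCl ℓ) m), ρ.toGaloisRep.IsSemisimple → (∀ᶠ v : IsDedekindDomain.HeightOneSpectrum (NumberField.RingOfIntegers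 K) in cofinite, SatakeFrobCompatibleAt ι π.1 ρ v) → ρ.toGaloisRep.IsIrreducible) → (∀ (ℓ : ℕ) [Fact ℓ.Prime] (ι : PadicAlgCl ℓ ≃+* ℂ), ∃ ρ : Literature.NumberTheory.GaloisRepresentations.FramedGaloisRep K (PadicAlgCl ℓ) n, ρ.toGaloisRep.IsSemisimple ∧ ∀ᶠ v : IsDedekindDomain.HeightOneSpectrum (NumberField.RingOfIntegers K) in cofinite, SatakeFrobCompatibleAt ι π.1 ρ v) → (∃ S : Finset ℕ, ∀ (ℓ : ℕ) [Fact ℓ.Prime], ℓ ∉ S → ∀ (ι : PadicAlgCl ℓ ≃+* ℂ) (ρ : Literature.NumberTheory.GaloisRepresentations.FramedGaloisRep K (PadicAlgCl ℓ) n), ρ.toGaloisRep.IsSemisimple → (∀ᶠ v : IsDedekindDomain.HeightOneSpectrum (NumberField.RingOfIntegers K) in cofinite, SatakeFrobCompatibleAt ι π.1 ρ v) → ρ.toGaloisRep.IsIrreducible) → ∀ (ℓ : ℕ) [Fact ℓ.Prime] (ι : PadicAlgCl ℓ ≃+* ℂ) (ρ : Literature.NumberTheory.GaloisRepresentations.FramedGaloisRep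 K (PadicAlgCl ℓ) n), ρ.toGaloisRep.IsSemisimple → (∀ᶠ v : IsDedekindDomain.HeightOneSpectrum (NumberField.RingOfIntegers K) in cofinite, SatakeFrobCompatibleAt ι π.1 ρ v) → ρ.toGaloisRep.IsIrreducible := stub_ipt_prime
  have hco : ∀ (K : Type) [Field K] [NumberField K] (n : ℕ) (hcpt : Literature.NumberTheory.Automorphic.isCompact_glFiniteIntegralLevel n K), 0 < n → 3 < n → ¬ n.Prime → ∀ (π : Literature.NumberTheory.Automorphic.CuspidalAutomorphicRepData n K hcpt), π.1.IsLAlgebraic → ¬ (∃ (v : IsDedekindDomain.HeightOneSpectrum (NumberField.RingOfIntegers K)) (πv : Literature.NumberTheory.Automorphic.SmoothIrrep (Matrix.GeneralLinearGroup (Fin n) (v.adicCompletion K))), π.1.HasLocalComponentAt v πv.ρ ∧ (∀ [MeasurableSpace (Matrix.GeneralLinearGroup (Fin n) (v.adicCompletion K) ⧸ Subgroup.center (Matrix.GeneralLinearGroup (Fin n) (v.adicCompletion K)))] [BorelSpace (Matrix.GeneralLinearGroup (Fin n) (v.adicCompletion K) ⧸ Subgroup.center (Matrix.GeneralLinearGroup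 (Fin n) (v.adicCompletion K)))] (μ : MeasureTheory.Measure (Matrix.GeneralLinearGroup (Fin n) (v.adicCompletion K) ⧸ Subgroup.center (Matrix.GeneralLinearGroup (Fin n) (v.adicCompletion K)))) [μ.IsHaarMeasure], πv.ρ.IsEssentiallyDiscreteSeries μ) ∧ ∃ χ : Matrix.GeneralLinearGroup (Fin n) (v.adicCompletion K) →* ℂˣ, IsOpen (χ.ker : Set (Matrix.GeneralLinearGroup (Fin n) (v.adicCompletion K))) ∧ ∃ w : πv.V, w ≠ 0 ∧ ∀ g ∈ Literature.NumberTheory.Automorphic.iwahoriGL n (v.adicCompletion K), (πv.ρ.twist χ) g w = w) → (∀ m : ℕ, m < n → ∀ (K : Type) [Field K] [NumberField K] (hcpt : Literature.NumberTheory.Automorphic.isCompact_glFiniteIntegralLevel m K), 0 < m → ∀ (π : Literature.NumberTheory.Automorphic.CuspidalAutomorphicRepData m K hcpt), π.1.IsLAlgebraic → ∀ (ℓ : ℕ) [Fact ℓ.Prime] (ι : PadicAlgCl ℓ ≃+* ℂ) (ρ : Literature.NumberTheory.GaloisRepresentations.FramedGaloisRep K (PadicAlgCl ℓ) m), ρ.toGaloisRep.IsSemisimple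 → (∀ᶠ v : IsDedekindDomain.HeightOneSpectrum (NumberField.RingOfIntegers K) in cofinite, SatakeFrobCompatibleAt ι π.1 ρ v) → ρ.toGaloisRep.IsIrreducible) → (∀ (ℓ : ℕ) [Fact ℓ.Prime] (ι : PadicAlgCl ℓ ≃+* ℂ), ∃ ρ : Literature.NumberTheory.GaloisRepresentations.FramedGaloisRep K (PadicAlgCl ℓ) n, ρ.toGaloisRep.IsSemisimple ∧ ∀ᶠ v : IsDedekindDomain.HeightOneSpectrum (NumberField.RingOfIntegers K) in cofinite, SatakeFrobCompatibleAt ι π.1 ρ v) → (∃ S : Finset ℕ, ∀ (ℓ : ℕ) [Fact ℓ.Prime], ℓ ∉ S → ∀ (ι : PadicAlgCl ℓ ≃+* ℂ) (ρ : Literature.NumberTheory.GaloisRepresentations.FramedGaloisRep K (PadicAlgCl ℓ) n), ρ.toGaloisRep.IsSemisimple → (∀ᶠ v : IsDedekindDomain.HeightOneSpectrum (NumberField.RingOfIntegers K) in cofinite, SatakeFrobCompatibleAt ι π.1 ρ v) → ρ.toGaloisRep.IsIrreducible) → ∀ (ℓ : ℕ) [Fact ℓ.Prime] (ι : PadicAlgCl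 ℓ ≃+* ℂ) (ρ : Literature.NumberTheory.GaloisRepresentations.FramedGaloisRep K (PadicAlgCl ℓ) n), ρ.toGaloisRep.IsSemisimple → (∀ᶠ v : IsDedekindDomain.HeightOneSpectrum (NumberField.RingOfIntegers K) in cofinite, SatakeFrobCompatibleAt ι π.1 ρ v) → ρ.toGaloisRep.IsIrreducible := stub_ipt_composite
  intro K _ _ n hcpt hn
  by_cases h3 : n ≤ 3
  · exact hle K n hcpt hn h3
  · have h3' : 3 < n := lt_of_not_ge h3
    by_cases hp : n.Prime
    · exact hpr K n hcpt hn h3' hp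
    · exact hco K n hcpt hn h3' hp


end Summit.Langlands.Langlands.Cruxes.IrreduciblePrimeTransport.Birth
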